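import Literature.MathematicalPhysics.QuantumManyBody.NeumannBoxParseval

/-!
# Route `BECDyadicChaining` — crux `BaseCoherentMass` (stmt-AtomisticToContinuum-13193), stub
`stub_sineGap`, auxiliary file: the sine (Dirichlet) modes of the cube

Helpers for the registered stub `stub_sineGap` (the one-body Dirichlet spectral gap of the cube
`(0,L)³` in sine form) of the line `registered` of the crux
`Summit.AtomisticToContinuum.BoseEinsteinCondensation.Theses.BECDyadicChaining.BaseCoherentMass`.
This file ports the Neumann/cosine machinery of
`Literature/MathematicalPhysics/QuantumManyBody/NeumannBoxParseval.lean` to the normalised SINE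
modes `e_n(t) = √(2/ℓ) sin(nπt/ℓ)` (`n ≥ 0`; `e_0 = 0`) and their products
`u_k(y) = ∏ⱼ e_{kⱼ}(yⱼ)`, `k ∈ ℕ^d`, on the cube `[0,ℓ]^d`:

* the **slicing engine for an arbitrary family of continuous one-dimensional modes**
  `e : ℕ → ℝ → ℝ` (`sineGap_tsum_mul_enorm_sq_coef_eq_of_fibre`; verbatim the engine
  `NeumannBox.tsum_mul_enorm_sq_coef_eq_of_fibre`, which only uses continuity of the modes and the
  product structure): slice `[0,ℓ]^{d+1} ≅ [0,ℓ] × [0,ℓ]^d` at a coordinate, a one-dimensional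
  identity on each fibre, Tonelli, the `d`-dimensional Parseval for the partial coefficients,
  Fubini;
* one dimension: the sine Parseval in the normalised modes (`ℝ≥0∞` form,
  `sineGap_tsum_enorm_sq_integral_sinMode_mul`, from `NeumannBox.hasSum_sq_integral_sin_mul`), the
  integration by parts `∫₀^ℓ cos(nπx/ℓ) g' = (nπ/ℓ) ∫₀^ℓ sin(nπx/ℓ) g` for `g ∈ C¹[0,ℓ]` with
  `g(0) = g(ℓ) = 0` (`sineGap_integral_cos_mul_deriv`), and the **Dirichlet form identity**
  `∫₀^ℓ |g'|² = ∑ₙ (nπ/ℓ)² (2/ℓ)|∫₀^ℓ sin(nπx/ℓ) g|²` (`sineGap_hasSum_sq_norm_deriv`, cosine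
  Parseval of `g'`);
* the cube: **sine Parseval** `∑_k |∫ u_k g|² = ∫_{[0,ℓ]^d} |g|²` for continuous `g`
  (`sineGap_tsum_enorm_sq_coef`), and the **Dirichlet form identity**
  `∑_k (π/ℓ)²|k|² |∫ u_k g|² = ∫_{[0,ℓ]^{d+1}} |∇g|²` for `g ∈ C¹` vanishing on the faces of the
  cube (`sineGap_tsum_waveNumber_sq_mul_enorm_sq_coef`,
  `sineGap_tsum_sum_waveNumber_sq_mul_enorm_sq_coef`).

No definitions: the modes are written out, `Real.sqrt (2 / ℓ) * Real.sin (n * π / ℓ * t)`.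

## References

* [LSSY2005] E. H. Lieb, R. Seiringer, J. P. Solovej, J. Yngvason, *The Mathematics of the Bose Gas
  and its Condensation*, Birkhäuser 2005: Ch. 2, after (2.50) (the Neumann analogue).
-/

noncomputable section

namespace Summit.AtomisticToContinuum.BoseEinsteinCondensation.Theorems.BaseCoherentMass

open Real intervalIntegral MeasureTheory Set Filter Complex
open scoped ENNReal NNReal Topology
open Literature.MathematicalPhysics.QuantumManyBody.NeumannBox

variable {d : ℕ} {ℓ : ℝ}

/-! ### The slicing engine for a general family of continuous one-dimensional modes -/

/-- The product mode with multi-index `insertNth i n k'` splits off its `i`-th factor. [folklore] -/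
theorem sineGap_prod_insertNth (e : ℕ → ℝ → ℝ) (i : Fin (d + 1)) (n : ℕ) (k' : Fin d → ℕ)
    (y : Fin (d + 1) → ℝ) :
    (∏ j, e ((i.insertNth n k' : Fin (d + 1) → ℕ) j) (y j)) =
      e n (y i) * ∏ j, e (k' j) (y (i.succAbove j)) := by
  rw [Fin.prod_univ_succAbove _ i]
  simp only [Fin.insertNth_apply_same, Fin.insertNth_apply_succAbove]

/-- **The partial coefficient is continuous**: for continuous modes `e_n` and continuous `g` on
`ℝ^{d+1}`, `y' ↦ ∫₀^ℓ e_n(t) g(y' with t inserted at i) dt` is continuous on `ℝ^d`. [folklore] -/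
theorem sineGap_continuous_partialCoeff {e : ℕ → ℝ → ℝ} (he : ∀ n, Continuous (e n))
    (i : Fin (d + 1)) {g : (Fin (d + 1) → ℝ) → ℂ} (hg : Continuous g) (n : ℕ) :
    Continuous fun y' : Fin d → ℝ =>
      ∫ t in (0 : ℝ)..ℓ, (e n t : ℂ) * g (i.insertNth t y') := by
  have : Continuous (Function.uncurry fun (y' : Fin d → ℝ) (t : ℝ) =>
      (e n t : ℂ) * g (i.insertNth t y')) := by
    apply Continuous.mul
    · exact continuous_ofReal.comp ((he n).comp continuous_snd)
    · exact hg.comp (Continuous.finInsertNth i continuous_snd continuous_fst)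
  exact intervalIntegral.continuous_parametric_intervalIntegral_of_continuous' this 0 ℓ

/-- **Fubini for the coefficients**: the coefficient of `g` on `[0,ℓ]^{d+1}` against the product
mode `u_{insertNth i n k'}` is the coefficient, on `[0,ℓ]^d` against `u_{k'}`, of the partial
coefficient `y' ↦ ∫₀^ℓ e_n(t) g(…t…) dt`. [folklore] -/
theorem sineGap_integral_Icc_prod_insertNth_mul (hℓ : 0 < ℓ) {e : ℕ → ℝ → ℝ}
    (he : ∀ n, Continuous (e n)) (i : Fin (d + 1))
    {g : (Fin (d + 1) → ℝ) → ℂ} (hg : Continuous g) (n : ℕ) (k' : Fin d → ℕ) :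
    ∫ y in Icc (0 : Fin (d + 1) → ℝ) (fun _ => ℓ),
        ((∏ j, e ((i.insertNth n k' : Fin (d + 1) → ℕ) j) (y j) : ℝ) : ℂ) * g y =
      ∫ y' in Icc (0 : Fin d → ℝ) (fun _ => ℓ), ((∏ j, e (k' j) (y' j) : ℝ) : ℂ) *
        ∫ t in (0 : ℝ)..ℓ, (e n t : ℂ) * g (i.insertNth t y') := by
  set E := MeasurableEquiv.piFinSuccAbove (fun _ : Fin (d + 1) => ℝ) i with hE
  have hmp : MeasurePreserving E volume (volume.prod volume) :=
    volume_preserving_piFinSuccAbove _ i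
  set F : ℝ × (Fin d → ℝ) → ℂ := fun z =>
    ((e n z.1 * ∏ j, e (k' j) (z.2 j) : ℝ) : ℂ) * g (i.insertNth z.1 z.2) with hF
  have hFc : Continuous F := by
    apply Continuous.mul
    · refine continuous_ofReal.comp ?_
      refine ((he n).comp continuous_fst).mul ?_
      exact continuous_finsetProd _ fun j _ =>
        (he (k' j)).comp ((continuous_apply j).comp continuous_snd)
    · exact hg.comp (Continuous.finInsertNth i continuous_fst continuous_snd)
  have hintegrand : ∀ y : Fin (d + 1) → ℝ,
      ((∏ j, e ((i.insertNth n k' : Fin (d + 1) → ℕ) j) (y j) : ℝ) : ℂ) * g y = F (E y) := by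
    intro y
    simp only [hF, hE, MeasurableEquiv.piFinSuccAbove_apply, Fin.insertNthEquiv_symm_apply,
      Fin.insertNth_self_removeNth, Fin.removeNth_apply, sineGap_prod_insertNth]
  simp_rw [hintegrand]
  rw [Icc_eq_preimage_piFinSuccAbove i ℓ, hmp.setIntegral_preimage_emb E.measurableEmbedding,
    ← Measure.prod_restrict]
  have hint : Integrable F ((volume.restrict (Icc (0 : ℝ) ℓ)).prod
      (volume.restrict (Icc (0 : Fin d → ℝ) fun _ => ℓ))) := by
    rw [Measure.prod_restrict]
    exact (hFc.continuousOn.integrableOn_compact (isCompact_Icc.prod isCompact_Icc))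
  rw [integral_prod_symm F hint]
  refine setIntegral_congr_fun measurableSet_Icc fun y' _ => ?_
  have h1 : ∀ t : ℝ, F (t, y') =
      ((∏ j, e (k' j) (y' j) : ℝ) : ℂ) * ((e n t : ℂ) * g (i.insertNth t y')) := by
    intro t; simp only [hF]; push_cast; ring
  simp_rw [h1]
  rw [MeasureTheory.integral_const_mul, integral_Icc_eq_integral_Ioc,
    ← intervalIntegral.integral_of_le hℓ.le]

/-- **The slicing engine, for a general family of continuous modes `e_n`.** Suppose Parseval holds
for the product modes `u_k = ∏ⱼ e_{kⱼ}` on `[0,ℓ]^d` (hypothesis `hA`, for all continuous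
functions).
Let `g` be continuous on `ℝ^{d+1}`, `i` a coordinate, and suppose on every fibre in the direction
`i` a one-dimensional identity `∑ₙ wₙ ‖∫₀^ℓ e_n(t) g(…t…) dt‖² = ∫₀^ℓ h(…t…) dt` holds. Then
`∑_k w_{kᵢ} ‖⟨u_k, g⟩‖² = ∫_{[0,ℓ]^{d+1}} h` (Tonelli over the slicing, the `d`-dimensional Parseval
for the continuous partial coefficients, Fubini for the coefficients). [folklore] -/
theorem sineGap_tsum_mul_enorm_sq_coef_eq_of_fibre (hℓ : 0 < ℓ) {e : ℕ → ℝ → ℝ}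
    (he : ∀ n, Continuous (e n))
    (hA : ∀ {g : (Fin d → ℝ) → ℂ}, Continuous g →
      ∑' k : Fin d → ℕ, ‖∫ y in Icc (0 : Fin d → ℝ) (fun _ => ℓ),
          ((∏ j, e (k j) (y j) : ℝ) : ℂ) * g y‖ₑ ^ 2 =
        ∫⁻ y in Icc (0 : Fin d → ℝ) (fun _ => ℓ), ‖g y‖ₑ ^ 2)
    (i : Fin (d + 1)) {g : (Fin (d + 1) → ℝ) → ℂ} (hg : Continuous g) (w : ℕ → ℝ≥0∞)
    {h : (Fin (d + 1) → ℝ) → ℝ≥0∞} (hh : Measurable h)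
    (hfib : ∀ y' : Fin d → ℝ,
      ∑' n : ℕ, w n * ‖∫ t in (0 : ℝ)..ℓ, (e n t : ℂ) * g (i.insertNth t y')‖ₑ ^ 2 =
        ∫⁻ t in Ioc 0 ℓ, h (i.insertNth t y')) :
    ∑' k : Fin (d + 1) → ℕ, w (k i) * ‖∫ y in Icc (0 : Fin (d + 1) → ℝ) (fun _ => ℓ),
        ((∏ j, e (k j) (y j) : ℝ) : ℂ) * g y‖ₑ ^ 2 =
      ∫⁻ y in Icc (0 : Fin (d + 1) → ℝ) (fun _ => ℓ), h y := by
  set E := MeasurableEquiv.piFinSuccAbove (fun _ : Fin (d + 1) => ℝ) i with hE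
  have hmp : MeasurePreserving E volume (volume.prod volume) :=
    volume_preserving_piFinSuccAbove _ i
  set G : ℕ → (Fin d → ℝ) → ℂ := fun n y' =>
    ∫ t in (0 : ℝ)..ℓ, (e n t : ℂ) * g (i.insertNth t y') with hG
  have hGc : ∀ n, Continuous (G n) := fun n => sineGap_continuous_partialCoeff he i hg n
  -- the right-hand side, sliced
  have hR : ∫⁻ y in Icc (0 : Fin (d + 1) → ℝ) (fun _ => ℓ), h y =
      ∫⁻ y' in Icc (0 : Fin d → ℝ) (fun _ => ℓ), ∫⁻ t in Ioc 0 ℓ, h (i.insertNth t y') := by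
    set H : ℝ × (Fin d → ℝ) → ℝ≥0∞ := fun z => h (E.symm z) with hH
    have h1 : ∫⁻ y in Icc (0 : Fin (d + 1) → ℝ) (fun _ => ℓ), h y =
        ∫⁻ y in E ⁻¹' (Icc (0 : ℝ) ℓ ×ˢ Icc (0 : Fin d → ℝ) fun _ => ℓ), H (E y) := by
      rw [← Icc_eq_preimage_piFinSuccAbove i ℓ]
      simp only [hH, MeasurableEquiv.symm_apply_apply]
    rw [h1, hmp.setLIntegral_comp_preimage_emb E.measurableEmbedding H, ← Measure.prod_restrict,
      lintegral_prod_symm H (show Measurable H from hh.comp E.symm.measurable).aemeasurable]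
    refine setLIntegral_congr_fun measurableSet_Icc fun y' _ => ?_
    rw [Measure.restrict_congr_set Ioc_ae_eq_Icc]
    rfl
  -- Tonelli for the sum over `n`, then the `d`-dimensional Parseval for each partial coefficient
  have hR2 : ∫⁻ y' in Icc (0 : Fin d → ℝ) (fun _ => ℓ), ∫⁻ t in Ioc 0 ℓ, h (i.insertNth t y') =
      ∑' n : ℕ, w n * ∑' k' : Fin d → ℕ, ‖∫ y' in Icc (0 : Fin d → ℝ) (fun _ => ℓ),
        ((∏ j, e (k' j) (y' j) : ℝ) : ℂ) * G n y'‖ₑ ^ 2 := by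
    simp_rw [← hfib]
    rw [lintegral_tsum fun n => ?_]
    · congr 1; funext n
      rw [lintegral_const_mul _ ((hGc n).measurable.enorm.pow_const 2), hA (hGc n)]
    · exact (((hGc n).measurable.enorm.pow_const 2).const_mul _).aemeasurable
  -- the left-hand side, re-indexed by `k = insertNth i n k'`
  have hL : ∑' k : Fin (d + 1) → ℕ, w (k i) * ‖∫ y in Icc (0 : Fin (d + 1) → ℝ) (fun _ => ℓ),
        ((∏ j, e (k j) (y j) : ℝ) : ℂ) * g y‖ₑ ^ 2 =
      ∑' n : ℕ, w n * ∑' k' : Fin d → ℕ, ‖∫ y' in Icc (0 : Fin d → ℝ) (fun _ => ℓ),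
        ((∏ j, e (k' j) (y' j) : ℝ) : ℂ) * G n y'‖ₑ ^ 2 := by
    rw [← (Fin.insertNthEquiv (fun _ => ℕ) i).tsum_eq]
    simp only [Fin.insertNthEquiv_apply, Fin.insertNth_apply_same]
    rw [ENNReal.tsum_prod']
    congr 1; funext n
    rw [← ENNReal.tsum_mul_left]
    congr 1; funext k'
    rw [sineGap_integral_Icc_prod_insertNth_mul hℓ he i hg n k']
  rw [hL, hR, hR2]

/-- Dimension zero: the cube `[0,ℓ]^0` is a point of mass one and `u_∅ = 1`. [folklore] -/
theorem sineGap_tsum_enorm_sq_coef_zero (e : ℕ → ℝ → ℝ) (ℓ : ℝ) (g : (Fin 0 → ℝ) → ℂ) :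
    ∑' k : Fin 0 → ℕ, ‖∫ y in Icc (0 : Fin 0 → ℝ) (fun _ => ℓ),
        ((∏ j, e (k j) (y j) : ℝ) : ℂ) * g y‖ₑ ^ 2 =
      ∫⁻ y in Icc (0 : Fin 0 → ℝ) (fun _ => ℓ), ‖g y‖ₑ ^ 2 := by
  have hI : (Icc (0 : Fin 0 → ℝ) fun _ => ℓ) = univ := by
    ext y
    simp only [Set.mem_Icc, Pi.le_def, IsEmpty.forall_iff, and_self, Set.mem_univ]
  have hvol : (volume : Measure (Fin 0 → ℝ)) = Measure.dirac default := by
    rw [volume_pi, Measure.pi_of_empty _ default]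
  rw [hI, Measure.restrict_univ, hvol, lintegral_dirac, tsum_fintype, Fintype.sum_unique]
  simp

/-! ### One dimension: the sine modes `e_n = √(2/ℓ) sin(nπt/ℓ)` and the Dirichlet form -/

/-- `‖∫₀^ℓ e_n f‖² = (2/ℓ)‖∫₀^ℓ sin(nπt/ℓ) f‖²` (`ℓ > 0`). [folklore] -/
theorem sineGap_norm_sq_integral_sinMode_mul (hℓ : 0 < ℓ) (n : ℕ) (f : ℝ → ℂ) :
    ‖∫ t in (0 : ℝ)..ℓ, ((Real.sqrt (2 / ℓ) * Real.sin (n * π / ℓ * t) : ℝ) : ℂ) * f t‖ ^ 2 =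
      2 / ℓ * ‖∫ t in (0 : ℝ)..ℓ, (Real.sin (n * π / ℓ * t) : ℂ) * f t‖ ^ 2 := by
  have h : ∫ t in (0 : ℝ)..ℓ, ((Real.sqrt (2 / ℓ) * Real.sin (n * π / ℓ * t) : ℝ) : ℂ) * f t =
      ((Real.sqrt (2 / ℓ) : ℝ) : ℂ) *
        ∫ t in (0 : ℝ)..ℓ, (Real.sin (n * π / ℓ * t) : ℂ) * f t := by
    rw [← intervalIntegral.integral_const_mul]
    congr 1; funext t; push_cast; ring
  rw [h, norm_mul, mul_pow, Complex.norm_real, Real.norm_eq_abs, sq_abs,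
    Real.sq_sqrt (by positivity)]

/-- **Sine Parseval in the normalised modes, `ℝ≥0∞` form**: for continuous `f : ℝ → ℂ` and
`ℓ > 0`, `∑ₙ ‖∫₀^ℓ e_n f‖² = ∫₀^ℓ ‖f‖²`, `e_n = √(2/ℓ) sin(nπt/ℓ)` (the `n = 0` term vanishes).
[folklore] -/
theorem sineGap_tsum_enorm_sq_integral_sinMode_mul (hℓ : 0 < ℓ) {f : ℝ → ℂ}
    (hf : Continuous f) :
    ∑' n : ℕ, ‖∫ t in (0 : ℝ)..ℓ,
        ((Real.sqrt (2 / ℓ) * Real.sin (n * π / ℓ * t) : ℝ) : ℂ) * f t‖ₑ ^ 2 =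
      ∫⁻ t in Ioc 0 ℓ, ‖f t‖ₑ ^ 2 := by
  rw [← ofReal_intervalIntegral_norm_sq hℓ.le hf,
    ← tsum_ofReal_eq_of_hasSum (fun n => by positivity) (hasSum_sq_integral_sin_mul hℓ hf)]
  congr 1; funext n
  rw [← ofReal_norm, ← ENNReal.ofReal_pow (norm_nonneg _),
    sineGap_norm_sq_integral_sinMode_mul hℓ]

/-- **Integration by parts with Dirichlet boundary values**: for `g ∈ C¹[0, ℓ]` (derivative `g'`
on `[0,ℓ]`, continuous) with `g(0) = g(ℓ) = 0` and `n ≥ 0`,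
`∫₀^ℓ cos(nπx/ℓ) g'(x) dx = (nπ/ℓ) ∫₀^ℓ sin(nπx/ℓ) g(x) dx` (the boundary term `[cos·g]₀^ℓ`
vanishes). [folklore] -/
theorem sineGap_integral_cos_mul_deriv (hℓ : 0 < ℓ) (n : ℕ) {g g' : ℝ → ℂ}
    (hg : ∀ x ∈ uIcc (0 : ℝ) ℓ, HasDerivAt g (g' x) x) (hg' : Continuous g')
    (h0 : g 0 = 0) (h1 : g ℓ = 0) :
    ∫ x in (0 : ℝ)..ℓ, (Real.cos (n * π / ℓ * x) : ℂ) * g' x =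
      ((n * π / ℓ : ℝ) : ℂ) * ∫ x in (0 : ℝ)..ℓ, (Real.sin (n * π / ℓ * x) : ℂ) * g x := by
  have _ := hℓ
  set k : ℝ := n * π / ℓ with hk
  have hu : ∀ x ∈ uIcc (0 : ℝ) ℓ, HasDerivAt (fun y : ℝ => (Real.cos (k * y) : ℂ))
      (((-(k * Real.sin (k * x)) : ℝ) : ℂ)) x := by
    intro x _
    have h1 : HasDerivAt (fun y : ℝ => k * y) k x := by
      simpa using (hasDerivAt_id x).const_mul k
    have h2 : HasDerivAt (fun y : ℝ => Real.cos (k * y)) (-Real.sin (k * x) * k) x := h1.cos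
    refine h2.ofReal_comp.congr_deriv ?_
    push_cast; ring
  have hu'int : IntervalIntegrable (fun x => (((-(k * Real.sin (k * x))) : ℝ) : ℂ)) volume 0 ℓ :=
    (Continuous.intervalIntegrable (by fun_prop) _ _)
  have hv'int : IntervalIntegrable g' volume 0 ℓ := hg'.intervalIntegrable _ _
  rw [intervalIntegral.integral_mul_deriv_eq_deriv_mul hu hg hu'int hv'int, h0, h1, mul_zero,
    mul_zero, sub_zero, zero_sub, ← intervalIntegral.integral_neg,
    ← intervalIntegral.integral_const_mul]
  congr 1
  funext x
  push_cast
  ring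

/-- **The Dirichlet form `∫₀^ℓ |g'|²` is diagonal in the sine modes, with eigenvalues `(nπ/ℓ)²`**:
for `ℓ > 0` and `g ∈ C¹[0,ℓ]` with `g(0) = g(ℓ) = 0`,
`∑_{n ≥ 0} (2/ℓ)(nπ/ℓ)² |∫₀^ℓ sin(nπx/ℓ) g|² = ∫₀^ℓ |g'|²` (cosine Parseval for `g'` and the
integration by parts `sineGap_integral_cos_mul_deriv`; the `n = 0` term is `ℓ⁻¹|g(ℓ) - g(0)|² = 0`).
Hence `-d²/dx²` with Dirichlet conditions on `(0,ℓ)` has form-spectrum `{(nπ/ℓ)² : n ≥ 1}`.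
[folklore] -/
theorem sineGap_hasSum_sq_norm_deriv (hℓ : 0 < ℓ) {g g' : ℝ → ℂ}
    (hg : ∀ x ∈ uIcc (0 : ℝ) ℓ, HasDerivAt g (g' x) x) (hg' : Continuous g')
    (h0 : g 0 = 0) (h1 : g ℓ = 0) :
    HasSum (fun n : ℕ => 2 / ℓ * (n * π / ℓ) ^ 2 *
        ‖∫ x in (0 : ℝ)..ℓ, (Real.sin (n * π / ℓ * x) : ℂ) * g x‖ ^ 2)
      (∫ x in (0 : ℝ)..ℓ, ‖g' x‖ ^ 2) := by
  have h := hasSum_sq_integral_cos_mul hℓ hg'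
  have hfun : (fun n : ℕ => (if n = 0 then 1 else 2) / ℓ *
      ‖∫ x in (0 : ℝ)..ℓ, (Real.cos (n * π / ℓ * x) : ℂ) * g' x‖ ^ 2) =
      fun n : ℕ => 2 / ℓ * (n * π / ℓ) ^ 2 *
        ‖∫ x in (0 : ℝ)..ℓ, (Real.sin (n * π / ℓ * x) : ℂ) * g x‖ ^ 2 := by
    funext n
    rw [sineGap_integral_cos_mul_deriv hℓ n hg hg' h0 h1, norm_mul, Complex.norm_real,
      Real.norm_eq_abs, mul_pow, sq_abs]
    rcases eq_or_ne n 0 with rfl | hn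
    · simp
    · rw [if_neg hn]; ring
  rwa [hfun] at h

/-- **The Dirichlet form in the normalised sine modes, `ℝ≥0∞` form**: for `g ∈ C¹[0,ℓ]` with
`g(0) = g(ℓ) = 0`, `∑ₙ (nπ/ℓ)² ‖∫₀^ℓ e_n g‖² = ∫₀^ℓ ‖g'‖²`. [folklore] -/
theorem sineGap_tsum_waveNumber_sq_mul_enorm_sq_integral_sinMode_mul (hℓ : 0 < ℓ) {g g' : ℝ → ℂ}
    (hg : ∀ x ∈ uIcc (0 : ℝ) ℓ, HasDerivAt g (g' x) x) (hg' : Continuous g')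
    (h0 : g 0 = 0) (h1 : g ℓ = 0) :
    ∑' n : ℕ, ENNReal.ofReal (waveNumber ℓ n ^ 2) * ‖∫ t in (0 : ℝ)..ℓ,
        ((Real.sqrt (2 / ℓ) * Real.sin (n * π / ℓ * t) : ℝ) : ℂ) * g t‖ₑ ^ 2 =
      ∫⁻ t in Ioc 0 ℓ, ‖g' t‖ₑ ^ 2 := by
  rw [← ofReal_intervalIntegral_norm_sq hℓ.le hg',
    ← tsum_ofReal_eq_of_hasSum (fun n => by positivity)
      (sineGap_hasSum_sq_norm_deriv hℓ hg hg' h0 h1)]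
  congr 1; funext n
  rw [← ofReal_norm, ← ENNReal.ofReal_pow (norm_nonneg _), ← ENNReal.ofReal_mul (sq_nonneg _),
    sineGap_norm_sq_integral_sinMode_mul hℓ, waveNumber]
  congr 1
  ring

/-! ### The cube `[0,ℓ]^d`: sine Parseval and the Dirichlet form identity -/

/-- The sine modes are continuous. [folklore] -/
theorem sineGap_continuous_sinMode (ℓ : ℝ) (n : ℕ) :
    Continuous fun t : ℝ => Real.sqrt (2 / ℓ) * Real.sin (n * π / ℓ * t) := by
  fun_prop

/-- **Sine Parseval on the cube `[0,ℓ]^d`** (`ℝ≥0∞` form): for `ℓ > 0` and continuous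
`g : ℝ^d → ℂ`, `∑_{k ∈ ℕ^d} ‖∫_{[0,ℓ]^d} u_k g‖² = ∫_{[0,ℓ]^d} ‖g‖²` for the product sine modes
`u_k(y) = ∏ⱼ √(2/ℓ) sin(kⱼπyⱼ/ℓ)` (the terms with some `kⱼ = 0` vanish) — the Dirichlet
eigenfunctions of the cube are complete in `L²`. Induction on `d` through the slicing engine with
the one-dimensional sine Parseval on each fibre. [folklore] -/
theorem sineGap_tsum_enorm_sq_coef (hℓ : 0 < ℓ) :
    ∀ (d : ℕ) {g : (Fin d → ℝ) → ℂ}, Continuous g →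
      ∑' k : Fin d → ℕ, ‖∫ y in Icc (0 : Fin d → ℝ) (fun _ => ℓ),
          ((∏ j, Real.sqrt (2 / ℓ) * Real.sin ((k j) * π / ℓ * (y j)) : ℝ) : ℂ) * g y‖ₑ ^ 2 =
        ∫⁻ y in Icc (0 : Fin d → ℝ) (fun _ => ℓ), ‖g y‖ₑ ^ 2
  | 0, g, _ => sineGap_tsum_enorm_sq_coef_zero
      (fun n t => Real.sqrt (2 / ℓ) * Real.sin (n * π / ℓ * t)) ℓ g
  | d + 1, g, hg => by
    have key := sineGap_tsum_mul_enorm_sq_coef_eq_of_fibre hℓ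
      (e := fun n t => Real.sqrt (2 / ℓ) * Real.sin (n * π / ℓ * t))
      (sineGap_continuous_sinMode ℓ)
      (fun hg' => sineGap_tsum_enorm_sq_coef hℓ d hg') 0 hg (fun _ => 1)
      (hg.measurable.enorm.pow_const 2) (fun y' => by
        have hc : Continuous fun t : ℝ => g (Fin.insertNth 0 t y') :=
          hg.comp (Continuous.finInsertNth 0 continuous_id continuous_const)
        simpa only [one_mul] using sineGap_tsum_enorm_sq_integral_sinMode_mul hℓ hc)
    simpa only [one_mul] using key

/-- **The Dirichlet form identity in one coordinate direction**: for `g ∈ C¹(ℝ^{d+1})` vanishing on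
the two faces `{yᵢ = 0}`, `{yᵢ = ℓ}` of the cube, `ℓ > 0`:
`∑_k (kᵢπ/ℓ)² ‖∫_{[0,ℓ]^{d+1}} u_k g‖² = ∫_{[0,ℓ]^{d+1}} ‖∂ᵢ g‖²` — the slicing engine with the
one-dimensional Dirichlet form identity on each fibre (which vanishes at both ends). [folklore] -/
theorem sineGap_tsum_waveNumber_sq_mul_enorm_sq_coef (hℓ : 0 < ℓ) (i : Fin (d + 1))
    {g : (Fin (d + 1) → ℝ) → ℂ} (hg : ContDiff ℝ 1 g)
    (hg0 : ∀ y : Fin (d + 1) → ℝ, y i = 0 → g y = 0)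
    (hg1 : ∀ y : Fin (d + 1) → ℝ, y i = ℓ → g y = 0) :
    ∑' k : Fin (d + 1) → ℕ, ENNReal.ofReal (waveNumber ℓ (k i) ^ 2) *
        ‖∫ y in Icc (0 : Fin (d + 1) → ℝ) (fun _ => ℓ),
          ((∏ j, Real.sqrt (2 / ℓ) * Real.sin ((k j) * π / ℓ * (y j)) : ℝ) : ℂ) * g y‖ₑ ^ 2 =
      ∫⁻ y in Icc (0 : Fin (d + 1) → ℝ) (fun _ => ℓ), ‖fderiv ℝ g y (Pi.single i 1)‖ₑ ^ 2 := by
  have hgd : Differentiable ℝ g := hg.differentiable one_ne_zero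
  have hdc : Continuous fun y => fderiv ℝ g y (Pi.single i 1) :=
    (hg.continuous_fderiv one_ne_zero).clm_apply continuous_const
  refine sineGap_tsum_mul_enorm_sq_coef_eq_of_fibre hℓ
    (e := fun n t => Real.sqrt (2 / ℓ) * Real.sin (n * π / ℓ * t)) (sineGap_continuous_sinMode ℓ)
    (fun hg' => sineGap_tsum_enorm_sq_coef hℓ d hg') i hg.continuous
    (fun n => ENNReal.ofReal (waveNumber ℓ n ^ 2)) (hdc.measurable.enorm.pow_const 2) fun y' => ?_
  have hc : Continuous fun t : ℝ => fderiv ℝ g (i.insertNth t y') (Pi.single i 1) :=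
    hdc.comp (Continuous.finInsertNth i continuous_id continuous_const)
  exact sineGap_tsum_waveNumber_sq_mul_enorm_sq_integral_sinMode_mul hℓ
    (fun t _ => hasDerivAt_comp_insertNth i hgd y' t) hc
    (hg0 _ (by simp)) (hg1 _ (by simp))

/-- **The Dirichlet form `∫|∇g|²` on the cube is diagonal in the product sine modes, with
eigenvalues `(π/ℓ)²|k|²** (`ℝ≥0∞` form): for `ℓ > 0` and `g ∈ C¹(ℝ^{d+1})` vanishing off the open
cube `(0,ℓ)^{d+1}` (so on all its faces),
`∑_k (∑ᵢ (kᵢπ/ℓ)²) ‖∫_{[0,ℓ]^{d+1}} u_k g‖² = ∫_{[0,ℓ]^{d+1}} ∑ᵢ ‖∂ᵢg‖²`: `-Δ` with Dirichlet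
conditions on the cube has form-spectrum `{(π/ℓ)²|k|² : k ∈ ℕ₊^{d+1}}` with eigenbasis `(u_k)`.
[folklore] -/
theorem sineGap_tsum_sum_waveNumber_sq_mul_enorm_sq_coef (hℓ : 0 < ℓ)
    {g : (Fin (d + 1) → ℝ) → ℂ} (hg : ContDiff ℝ 1 g)
    (hgz : ∀ (y : Fin (d + 1) → ℝ) (j : Fin (d + 1)), y j ∉ Ioo (0 : ℝ) ℓ → g y = 0) :
    ∑' k : Fin (d + 1) → ℕ, ENNReal.ofReal (∑ i, waveNumber ℓ (k i) ^ 2) *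
        ‖∫ y in Icc (0 : Fin (d + 1) → ℝ) (fun _ => ℓ),
          ((∏ j, Real.sqrt (2 / ℓ) * Real.sin ((k j) * π / ℓ * (y j)) : ℝ) : ℂ) * g y‖ₑ ^ 2 =
      ∫⁻ y in Icc (0 : Fin (d + 1) → ℝ) (fun _ => ℓ),
        ∑ i, ‖fderiv ℝ g y (Pi.single i 1)‖ₑ ^ 2 := by
  have hdc : ∀ i : Fin (d + 1), Continuous fun y => fderiv ℝ g y (Pi.single i 1) := fun i =>
    (hg.continuous_fderiv one_ne_zero).clm_apply continuous_const
  rw [lintegral_finsetSum _ fun i _ => (hdc i).measurable.enorm.pow_const 2]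
  simp_rw [ENNReal.ofReal_sum_of_nonneg (fun i _ => sq_nonneg _), Finset.sum_mul]
  rw [Summable.tsum_finsetSum fun i _ => ENNReal.summable]
  refine Finset.sum_congr rfl fun i _ => sineGap_tsum_waveNumber_sq_mul_enorm_sq_coef hℓ i hg
    (fun y hy => hgz y i (by rw [hy]; exact fun h => lt_irrefl _ h.1))
    (fun y hy => hgz y i (by rw [hy]; exact fun h => lt_irrefl _ h.2))

/-- **Sine Parseval on the cube, registered form** (the sub-goal stub `sineGapAux_parseval` of the
crux item; all hypotheses after the colon): for `ℓ > 0`, every dimension `d` and every continuous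
`g : ℝ^d → ℂ`, `∑_{k ∈ ℕ^d} ‖∫_{[0,ℓ]^d} u_k g‖² = ∫_{[0,ℓ]^d} ‖g‖²` for the product sine modes
`u_k(y) = ∏ⱼ √(2/ℓ) sin(kⱼπyⱼ/ℓ)`. [folklore] -/
theorem sineGapAux_parseval : ∀ (ℓ : ℝ), 0 < ℓ → ∀ (d : ℕ) (g : (Fin d → ℝ) → ℂ), Continuous g → ∑' k : Fin d → ℕ, ‖∫ y in Set.Icc (0 : Fin d → ℝ) (fun _ => ℓ), ((∏ j, (Real.sqrt (2 / ℓ) * Real.sin ((k j : ℝ) * Real.pi / ℓ * y j)) : ℝ) : ℂ) * g y‖ₑ ^ 2 = ∫⁻ y in Set.Icc (0 : Fin d → ℝ) (fun _ => ℓ), ‖g y‖ₑ ^ 2 :=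
  fun _ hℓ d _ hg => sineGap_tsum_enorm_sq_coef hℓ d hg

end Summit.AtomisticToContinuum.BoseEinsteinCondensation.Theorems.BaseCoherentMass

end
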